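import Literature.Topology.FourManifolds.FoldPushPlane
import HarnessLib

/-!
# The value-based push of a map near a fold arc: the model

Topic `Literature/Topology/FourManifolds` (programme of the fact
`Literature.Topology.FourManifolds.exists_isSimplifiedBrokenLefschetzFibration`, Baykur–Saeki 2017, §2.1,
§3).  The push of `FoldPushModel` perturbs the fold MODEL `F₀`; along the normal-crossing
induction the map to be pushed is no longer in normal form in the original chart (earlier
pushes have modified it), so we push an arbitrary `C^∞` local representative
`F : ℝ⁴ ⊇ O → ℝ²` by the VALUE-based bump

  `β(y) = β₁(F(y)₀) β₂(x)`,  `F_θ(y) = F(y) + β(y) θ`   (`y = (t, x)`).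

Where `β₂ ≡ 1` (the core tube `‖x‖ < r`), `F_θ = T_θ ∘ F` EXACTLY, with the plane map
`T_θ(w) = w + β₁(w₀) θ` of `FoldPushPlane` — a local diffeomorphism for small `θ` — so there
the critical set and the singularity types are unchanged whatever `F` is; on the rest of the
support `F` is assumed submersive and stays so for small `θ` (openness of surjectivity, jointly
in `(θ, y)`, over a compact set); off the support `F_θ = F`.

* `ValuePush.bump`, `ValuePush.pushMap`, `pushMap_eventuallyEq_comp`,
  `hasFDerivAt_pushMap`, `exists_surjective_fderiv_pushMap_iff` (critical set unchanged).

Everything is proved; the two model maps are the only definitions; no named facts (D-0026).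

## References

* R. İ. Baykur, O. Saeki, *Simplifying indefinite fibrations on 4-manifolds*, arXiv:1705.11169,
  §2.1 p. 6, §3. [BaykurSaeki2017]
* M. Golubitsky, V. Guillemin, *Stable Mappings and Their Singularities*, GTM 14 (1973), Ch. III
  §4. [GolubitskyGuillemin1973]
-/

noncomputable section

set_option maxSynthPendingDepth 2

open Set Function Filter Module Metric
open scoped ContDiff Topology

namespace Literature.Topology.FourManifolds

/-- Local notation: `𝔼 n` is the model Euclidean space `EuclideanSpace ℝ (Fin n)`. -/
local notation "𝔼 " n:arg => EuclideanSpace ℝ (Fin n)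

/-- Local notation: the coordinate covectors of `ℝ²`. -/
local notation "π₂" => (EuclideanSpace.proj (𝕜 := ℝ) (ι := Fin 2))

namespace ValuePush

open FoldPush (pushPlaneMap pushPlaneDeriv hasFDerivAt_pushPlaneMap injective_pushPlaneDeriv)

variable (F : 𝔼 4 → 𝔼 2) (β₁ : ContDiffBump (0 : ℝ)) (β₂ : ContDiffBump (0 : 𝔼 3))

/-- **The value-based push bump** `β(y) = β₁(F(y)₀) β₂(x)`. [cite: BaykurSaeki2017, §3] -/
def bump (y : 𝔼 4) : ℝ := β₁ (F y 0) * β₂ (fibrePart y)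

/-- **The value-based pushed map** `F_θ(y) = F(y) + β(y) θ`. [cite: BaykurSaeki2017, §3] -/
def pushMap (θ : 𝔼 2) (y : 𝔼 4) : 𝔼 2 := F y + bump F β₁ β₂ y • θ

variable {F β₁ β₂}

/-- `|β| ≤ 1`. [folklore] -/
theorem abs_bump_le_one (y : 𝔼 4) : |bump F β₁ β₂ y| ≤ 1 := by
  rw [bump, abs_mul]
  have h1 : |β₁ (F y 0)| ≤ 1 := by rw [abs_of_nonneg β₁.nonneg]; exact β₁.le_one
  have h2 : |β₂ (fibrePart y)| ≤ 1 := by rw [abs_of_nonneg β₂.nonneg]; exact β₂.le_one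
  calc |β₁ (F y 0)| * |β₂ (fibrePart y)| ≤ 1 * 1 := by gcongr
    _ = 1 := one_mul 1

/-- In the core tube `‖x‖ < r_in(β₂)` the bump is `β₁(F(y)₀)`. [folklore] -/
theorem bump_eventuallyEq {y : 𝔼 4} (hy : ‖fibrePart y‖ < β₂.rIn) :
    bump F β₁ β₂ =ᶠ[𝓝 y] fun z => β₁ (F z 0) := by
  have h1 : (β₂ : 𝔼 3 → ℝ) =ᶠ[𝓝 (fibrePart y)] 1 :=
    β₂.eventuallyEq_one_of_mem_ball (by simpa using hy)
  have h2 := (fibrePart.continuous.continuousAt (x := y)).eventually h1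
  filter_upwards [h2] with z hz
  simp only [bump, hz, Pi.one_apply, mul_one]

/-- **In the core tube `F_θ = T_θ ∘ F`.** [cite: BaykurSaeki2017, §3] -/
theorem pushMap_eventuallyEq_comp {y : 𝔼 4} (hy : ‖fibrePart y‖ < β₂.rIn) (θ : 𝔼 2) :
    pushMap F β₁ β₂ θ =ᶠ[𝓝 y] (pushPlaneMap β₁ θ ∘ F) := by
  filter_upwards [bump_eventuallyEq (F := F) (β₁ := β₁) hy] with z hz
  simp only [pushMap, hz, Function.comp_apply, pushPlaneMap]

/-- Off the support of the bump, `F_θ = F` near the point. [folklore] -/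
theorem pushMap_eventuallyEq_of_notMem {y : 𝔼 4} (hy : y ∉ tsupport (bump F β₁ β₂)) (θ : 𝔼 2) :
    pushMap F β₁ β₂ θ =ᶠ[𝓝 y] F := by
  have h : (bump F β₁ β₂) =ᶠ[𝓝 y] 0 := by
    rw [← notMem_tsupport_iff_eventuallyEq] at *
    exact hy
  filter_upwards [h] with z hz
  simp only [pushMap, hz, Pi.zero_apply, zero_smul, add_zero]

section Smooth

variable {O : Set (𝔼 4)}

/-- The bump is `C^∞` where `F` is. [folklore] -/
theorem contDiffOn_bump (hF : ContDiffOn ℝ ∞ F O) : ContDiffOn ℝ ∞ (bump F β₁ β₂) O :=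
  (β₁.contDiff.comp_contDiffOn ((π₂ 0).contDiff.comp_contDiffOn hF)).mul
    (β₂.contDiff.comp fibrePart.contDiff).contDiffOn

/-- `F_θ` is `C^∞` where `F` is. [folklore] -/
theorem contDiffOn_pushMap (hF : ContDiffOn ℝ ∞ F O) (θ : 𝔼 2) :
    ContDiffOn ℝ ∞ (pushMap F β₁ β₂ θ) O :=
  hF.add ((contDiffOn_bump hF).smul contDiffOn_const)

/-- `(θ, y) ↦ F_θ(y)` is `C^∞` on `ℝ² × O`. [folklore] -/
theorem contDiffOn_pushMap_family (hF : ContDiffOn ℝ ∞ F O) :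
    ContDiffOn ℝ ∞ (fun p : 𝔼 2 × 𝔼 4 => pushMap F β₁ β₂ p.1 p.2) ((univ : Set (𝔼 2)) ×ˢ O) := by
  have h1 : ContDiffOn ℝ ∞ (fun p : 𝔼 2 × 𝔼 4 => F p.2) ((univ : Set (𝔼 2)) ×ˢ O) :=
    hF.comp contDiffOn_snd fun p hp => hp.2
  have h2 : ContDiffOn ℝ ∞ (fun p : 𝔼 2 × 𝔼 4 => bump F β₁ β₂ p.2) ((univ : Set (𝔼 2)) ×ˢ O) :=
    (contDiffOn_bump hF).comp contDiffOn_snd fun p hp => hp.2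
  exact h1.add (h2.smul contDiffOn_fst)

/-- The differential of `F_θ` at a point of the open set `O`. [folklore] -/
theorem hasFDerivAt_pushMap (hO : IsOpen O) (hF : ContDiffOn ℝ ∞ F O) (θ : 𝔼 2) {y : 𝔼 4}
    (hy : y ∈ O) :
    HasFDerivAt (pushMap F β₁ β₂ θ)
      (fderiv ℝ F y + (fderiv ℝ (bump F β₁ β₂) y).smulRight θ) y := by
  have h1 : HasFDerivAt F (fderiv ℝ F y) y :=
    ((hF.contDiffAt (hO.mem_nhds hy)).differentiableAt (by simp)).hasFDerivAt
  have h2 : HasFDerivAt (bump F β₁ β₂) (fderiv ℝ (bump F β₁ β₂) y) y :=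
    (((contDiffOn_bump hF).contDiffAt (hO.mem_nhds hy)).differentiableAt (by simp)).hasFDerivAt
  exact h1.add (h2.smul_const θ)

/-- The joint differential `(θ, y) ↦ dF_θ(y)` is continuous on `ℝ² × O`. [folklore] -/
theorem continuousOn_jointDeriv (hO : IsOpen O) (hF : ContDiffOn ℝ ∞ F O) :
    ContinuousOn (fun p : 𝔼 2 × 𝔼 4 =>
      fderiv ℝ F p.2 + (fderiv ℝ (bump F β₁ β₂) p.2).smulRight p.1) ((univ : Set (𝔼 2)) ×ˢ O) := by
  have h1 : ContinuousOn (fun p : 𝔼 2 × 𝔼 4 => fderiv ℝ F p.2) ((univ : Set (𝔼 2)) ×ˢ O) :=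
    (hF.continuousOn_fderiv_of_isOpen hO (by simp)).comp continuousOn_snd fun p hp => hp.2
  have h2 : ContinuousOn (fun p : 𝔼 2 × 𝔼 4 => fderiv ℝ (bump F β₁ β₂) p.2)
      ((univ : Set (𝔼 2)) ×ˢ O) :=
    ((contDiffOn_bump hF).continuousOn_fderiv_of_isOpen hO (by simp)).comp continuousOn_snd
      fun p hp => hp.2
  have h3 := (ContinuousLinearMap.smulRightL ℝ (𝔼 4) (𝔼 2)).continuous₂.comp_continuousOn
    (h2.prodMk continuousOn_fst)
  have h4 : ContinuousOn (fun p : 𝔼 2 × 𝔼 4 => (fderiv ℝ (bump F β₁ β₂) p.2).smulRight p.1)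
      ((univ : Set (𝔼 2)) ×ˢ O) :=
    h3.congr fun p _ => by simp [Function.comp, Function.uncurry]
  exact h1.add h4

end Smooth

/-! ### The critical set is unchanged -/

/-- A bound for `|β₁'|` and the resulting invertibility of `dT_θ`. [folklore] -/
theorem exists_bound_pushPlaneDeriv (β₁ : ContDiffBump (0 : ℝ)) :
    ∃ ε > 0, ∀ θ : 𝔼 2, ‖θ‖ < ε → ∀ w : 𝔼 2, Bijective (pushPlaneDeriv β₁ θ w) := by
  obtain ⟨C, hC⟩ := (β₁.contDiff (n := ⊤)).continuous_deriv (by simp)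
    |>.bounded_above_of_compact_support β₁.hasCompactSupport.deriv
  refine ⟨1 / (2 * |C| + 2), by positivity, fun θ hθ w => ?_⟩
  have hc : 1 + θ 0 * deriv β₁ (w 0) ≠ 0 := by
    have h1 : |deriv β₁ (w 0)| ≤ |C| := (hC (w 0)).trans (le_abs_self C)
    have h2 : |θ 0| ≤ ‖θ‖ := by simpa using PiLp.norm_apply_le θ 0
    have h3 : |θ 0 * deriv β₁ (w 0)| < 1 / 2 := by
      rw [abs_mul]
      calc |θ 0| * |deriv β₁ (w 0)| ≤ ‖θ‖ * |C| := by gcongr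
        _ ≤ 1 / (2 * |C| + 2) * |C| := by gcongr
        _ < 1 / 2 := by
          rw [div_mul_eq_mul_div, one_mul, div_lt_div_iff₀ (by positivity) (by positivity)]
          linarith [abs_nonneg C]
    intro h0
    have : θ 0 * deriv β₁ (w 0) = -1 := by linarith
    rw [this, abs_neg, abs_one] at h3
    norm_num at h3
  have hinj := injective_pushPlaneDeriv β₁ hc
  exact ⟨hinj, LinearMap.surjective_of_injective (f := (pushPlaneDeriv β₁ θ w).toLinearMap) hinj⟩

/-- **The value-based push does not change the critical set.**  Let `F` be `C^∞` on the open
set `O ⊆ ℝ⁴`, let the bump `β(y) = β₁(F(y)₀)β₂(x)` vanish on `O` outside a compact `K ⊆ O`,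
and let every critical point of `F` in `O` lie in the core tube `‖x‖ < r_in(β₂)`.  Then for
`‖θ‖` small, `F_θ = F + β θ` and `F` have the same critical points in `O`.
[cite: BaykurSaeki2017, §2.1 p. 6, §3] -/
theorem exists_surjective_fderiv_pushMap_iff {O K : Set (𝔼 4)} (hO : IsOpen O)
    (hF : ContDiffOn ℝ ∞ F O) (hK : IsCompact K) (hKO : K ⊆ O)
    (hsupp : ∀ y ∈ O, bump F β₁ β₂ y ≠ 0 → y ∈ K)
    (hcrit : ∀ y ∈ O, ¬ Surjective (fderiv ℝ F y) → ‖fibrePart y‖ < β₂.rIn) :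
    ∃ ε > 0, ∀ θ : 𝔼 2, ‖θ‖ < ε → ∀ y ∈ O,
      (Surjective (fderiv ℝ (pushMap F β₁ β₂ θ) y) ↔ Surjective (fderiv ℝ F y)) := by
  -- Region B: the compact part of the support outside the core tube
  set KB : Set (𝔼 4) := K ∩ {y | β₂.rIn ≤ ‖fibrePart y‖} with hKB
  have hKBc : IsCompact KB :=
    hK.inter_right (isClosed_le continuous_const (continuous_norm.comp fibrePart.continuous))
  set D : 𝔼 2 × 𝔼 4 → 𝔼 4 →L[ℝ] 𝔼 2 := fun p =>
    fderiv ℝ F p.2 + (fderiv ℝ (bump F β₁ β₂) p.2).smulRight p.1 with hD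
  have hDc : ContinuousOn D ((univ : Set (𝔼 2)) ×ˢ O) := continuousOn_jointDeriv hO hF
  have hOpen : IsOpen {p ∈ (univ : Set (𝔼 2)) ×ˢ O | Surjective (D p)} :=
    isOpen_inter_setOf_surjective (isOpen_univ.prod hO) hDc
  have hB : ∀ᶠ θ in 𝓝 (0 : 𝔼 2), ∀ y ∈ KB, Surjective (D (θ, y)) := by
    refine hKBc.eventually_forall_of_forall_eventually fun y hy => ?_
    have hyO : y ∈ O := hKO hy.1
    have hsurj : Surjective (D (0, y)) := by
      have h0 : D (0, y) = fderiv ℝ F y := by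
        simp only [hD]
        rw [show (fderiv ℝ (bump F β₁ β₂) y).smulRight (0 : 𝔼 2) = 0 by ext v; simp, add_zero]
      rw [h0]
      by_contra hns
      exact not_lt.2 hy.2 (hcrit y hyO hns)
    have hmem : ((0 : 𝔼 2), y) ∈ {p ∈ (univ : Set (𝔼 2)) ×ˢ O | Surjective (D p)} :=
      ⟨⟨mem_univ _, hyO⟩, hsurj⟩
    filter_upwards [hOpen.mem_nhds hmem] with p hp
    exact hp.2
  obtain ⟨ε₂, hε₂, hball⟩ := Metric.eventually_nhds_iff.1 hB
  -- Region A: invertibility of `dT_θ`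
  obtain ⟨ε₁, hε₁, hbij⟩ := exists_bound_pushPlaneDeriv β₁
  refine ⟨min ε₁ ε₂, lt_min hε₁ hε₂, fun θ hθ y hyO => ?_⟩
  have hθ₁ : ‖θ‖ < ε₁ := lt_of_lt_of_le hθ (min_le_left _ _)
  have hθ₂ : dist θ 0 < ε₂ := by
    rw [dist_zero_right]; exact lt_of_lt_of_le hθ (min_le_right _ _)
  have hFd : HasFDerivAt F (fderiv ℝ F y) y :=
    ((hF.contDiffAt (hO.mem_nhds hyO)).differentiableAt (by simp)).hasFDerivAt
  by_cases hA : ‖fibrePart y‖ < β₂.rIn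
  · -- Region A: `F_θ = T_θ ∘ F` near `y`
    have hev := pushMap_eventuallyEq_comp (F := F) (β₁ := β₁) hA θ
    rw [hev.fderiv_eq]
    have hcomp : HasFDerivAt (pushPlaneMap β₁ θ ∘ F)
        ((pushPlaneDeriv β₁ θ (F y)).comp (fderiv ℝ F y)) y :=
      (hasFDerivAt_pushPlaneMap β₁ θ (F y)).comp y hFd
    rw [hcomp.fderiv, ContinuousLinearMap.coe_comp]
    exact ⟨fun h => (Surjective.of_comp_iff' (hbij θ hθ₁ (F y)) _).1 h,
      fun h => (hbij θ hθ₁ (F y)).2.comp h⟩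
  · by_cases hyK : y ∈ K
    · -- Region B
      have hyB : y ∈ KB := ⟨hyK, not_lt.1 hA⟩
      have hsurjθ : Surjective (D (θ, y)) := hball hθ₂ y hyB
      have hsurj0 : Surjective (fderiv ℝ F y) := by
        by_contra hns
        exact hA (hcrit y hyO hns)
      rw [(hasFDerivAt_pushMap hO hF θ hyO).fderiv]
      exact ⟨fun _ => hsurj0, fun _ => hsurjθ⟩
    · -- Region C: off the support
      have hnot : y ∉ tsupport (bump F β₁ β₂) := by
        intro hyt
        -- near `y` inside `O`, the bump vanishes off `K`; `K` is closed and `y ∉ K`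
        have hev : bump F β₁ β₂ =ᶠ[𝓝 y] 0 := by
          filter_upwards [hO.mem_nhds hyO, hK.isClosed.isOpen_compl.mem_nhds hyK] with z hz hzK
          by_contra hne
          exact hzK (hsupp z hz hne)
        exact (notMem_tsupport_iff_eventuallyEq.2 hev) hyt
      rw [(pushMap_eventuallyEq_of_notMem hnot θ).fderiv_eq]

end ValuePush

end Literature.Topology.FourManifolds
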